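import Summits.Schanuel.Schanuel.Theorems.RootDecomp1LadderCollapseCore

/-!
# RootDecomp1LadderCollapse — part 2/2: the padding theorem and the COLLAPSE `DefectOneSchanuel → RationalImageSchanuel → LinearSchanuel ∧ QuadraticSchanuel` (§6)

Continuation of `RootDecomp1LadderCollapseCore` (lens 1 gen 12 «Ladder collapse» on route-Schanuel-RootDecomp1 rev 20: the rows L 27145 and Q 28369 are THEOREMS of B 25020 ∧ U⊥ 29644 —
a kernel MERGE removing two cone rows; two-part split of the 417-line port under the 400-line rule, same namespace). `--supports stmt-Schanuel-29644`; evidence on 27145 / 28369 / 25020.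
Sorry-free; standard axioms. Nothing here proves Schanuel; rung 0.
-/

noncomputable section

set_option linter.dupNamespace false

namespace Summit.Schanuel.Schanuel.Theorems.RootDecomp1LadderCollapse

open Complex IntermediateField
open scoped BigOperators
open Summit.Schanuel.Schanuel.Theses.RootDecomp1 (DefectOneSchanuel LinearSchanuel QuadraticSchanuel
  RationalImageSchanuel)
open Literature.NumberTheory.Transcendental (transcendental_exp_holds)
open Literature.NumberTheory.Transcendental.OneMotiveToric (trdeg_mono)
open Literature.NumberTheory.Transcendental.Philippon1986_criterion (trdeg_adjoin_range_le)
open Literature.Barriers.Schanuel (algebraicIndependent_of_le_trdeg_adjoin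
  trdeg_adjoin_union_eq_of_isAlgebraic)

/-! ## 6. The padding theorem and the collapse -/

/-- Coefficients of a polynomial mapped along `ℚ̄ → ℂ` are algebraic. -/
theorem algCoeff_map {m : ℕ} (P : MvPolynomial (Fin m) Qbar) (μ : Fin m →₀ ℕ) :
    IsAlgebraic ℚ (MvPolynomial.coeff μ (MvPolynomial.map (algebraMap Qbar ℂ) P)) := by
  rw [MvPolynomial.coeff_map]
  exact (MvPolynomial.coeff μ P).2

/-- Evaluation commutes with the coefficient map `ℚ̄ → ℂ`. -/
theorem eval_map_Qbar {m : ℕ} (s : Fin m → ℂ) (P : MvPolynomial (Fin m) Qbar) :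
    MvPolynomial.eval s (MvPolynomial.map (algebraMap Qbar ℂ) P) = MvPolynomial.aeval s P := by
  rw [MvPolynomial.eval_map]
  rfl

/-- **PADDING THEOREM (`B ∧ U⊥` ⟹ bounded-degree polynomial Schanuel).**  Assume B and U⊥.  If `z`
is ℚ-l.i. of length `n`, its coordinates are ℚ̄-polynomials of total degree ≤ d (d ≥ 1) in
`t : Fin k → ℂ` and its exponentials are ℚ̄-polynomials in the same `t`, then `n ≤ k`. -/
theorem collapse_core (hB : DefectOneSchanuel) (hU : RationalImageSchanuel) {n k d : ℕ} (hd : 1 ≤ d)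
    (z : Fin n → ℂ) (t : Fin k → ℂ) (hz : LinearIndependent ℚ z)
    (N E : Fin n → MvPolynomial (Fin k) Qbar) (hN : ∀ i, (N i).totalDegree ≤ d)
    (hzN : ∀ i, z i = MvPolynomial.aeval t (N i)) (hzE : ∀ i, cexp (z i) = MvPolynomial.aeval t (E i)) :
    n ≤ k := by
  by_contra hkn
  push Not at hkn
  obtain ⟨hn, hta⟩ := numerics hB z t hz N E hzN hzE hkn
  rcases Nat.eq_zero_or_pos k with hk | hk
  · -- no parameters: z₀ and e^{z₀} are algebraic, z₀ ≠ 0 — Hermite–Lindemann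
    subst hk
    have i : Fin n := ⟨0, by omega⟩
    have hz0 : z i ≠ 0 := hz.ne_zero i
    have hza : IsAlgebraic ℚ (z i) := by
      rw [hzN i, MvPolynomial.eq_C_of_isEmpty (N i), MvPolynomial.aeval_C, Subalgebra.algebraMap_def]
      exact (MvPolynomial.coeff 0 (N i)).2
    have hea : IsAlgebraic ℚ (cexp (z i)) := by
      rw [hzE i, MvPolynomial.eq_C_of_isEmpty (E i), MvPolynomial.aeval_C, Subalgebra.algebraMap_def]
      exact (MvPolynomial.coeff 0 (E i)).2
    exact transcendental_exp_holds hza hz0 hea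
  · set j₀ : Fin k := ⟨0, hk⟩ with hj₀
    have htS : AlgebraicIndependent Qbar t := hta.subalgebraAlgebraicClosure
    have hu : Transcendental ℚ (t j₀) := hta.transcendental j₀
    -- the padded tuple and its parameters
    set x : Fin (n + 2) → ℂ := Fin.append (n := 2) z ![t j₀ ^ (d + 1), t j₀ ^ (d + 2)] with hx
    set s : Fin (k + 2) → ℂ :=
      Fin.append (n := 2) t ![cexp (t j₀ ^ (d + 1)), cexp (t j₀ ^ (d + 2))] with hs
    have hxli : LinearIndependent ℚ x := linearIndependent_pad z t hz htS N hN hzN j₀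
    set N' : Fin (n + 2) → MvPolynomial (Fin (k + 2)) Qbar :=
      Fin.append (n := 2) (fun i => MvPolynomial.rename (Fin.castAdd 2) (N i))
        ![MvPolynomial.X (Fin.castAdd 2 j₀) ^ (d + 1), MvPolynomial.X (Fin.castAdd 2 j₀) ^ (d + 2)]
      with hN'
    set E' : Fin (n + 2) → MvPolynomial (Fin (k + 2)) Qbar :=
      Fin.append (n := 2) (fun i => MvPolynomial.rename (Fin.castAdd 2) (E i))
        ![MvPolynomial.X (Fin.natAdd k 0), MvPolynomial.X (Fin.natAdd k 1)] with hE'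
    have hst : s ∘ Fin.castAdd 2 = t := funext fun i => by simp [hs]
    have hsj : s (Fin.castAdd 2 j₀) = t j₀ := by simp [hs]
    have hxN' : ∀ i, x i = MvPolynomial.aeval s (N' i) := by
      intro i
      refine Fin.addCases (fun i => ?_) (fun j => ?_) i
      · simp only [hx, hN', Fin.append_left, MvPolynomial.aeval_rename, hst]
        exact hzN i
      · fin_cases j
        · simp [hx, hN', Fin.append_right, MvPolynomial.aeval_X, hsj]
        · simp [hx, hN', Fin.append_right, MvPolynomial.aeval_X, hsj]
    have hxE' : ∀ i, cexp (x i) = MvPolynomial.aeval s (E' i) := by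
      intro i
      refine Fin.addCases (fun i => ?_) (fun j => ?_) i
      · simp only [hx, hE', Fin.append_left, MvPolynomial.aeval_rename, hst]
        exact hzE i
      · fin_cases j
        · simp [hx, hE', hs, Fin.append_right, MvPolynomial.aeval_X]
        · simp [hx, hE', hs, Fin.append_right, MvPolynomial.aeval_X]
    -- the clauses of U⊥ at x
    have hx₁ : x (Fin.natAdd n 0) = t j₀ ^ (d + 1) := by simp [hx]
    have hx₂ : x (Fin.natAdd n 1) = t j₀ ^ (d + 2) := by simp [hx]
    have hquad := pad_quadratic_clause hB hd x hxli (t j₀) hu (Fin.natAdd n 0) (Fin.natAdd n 1) hx₁ hx₂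
    have haff : ∀ (k' : ℕ) (t' : Fin k' → ℂ) (β₀ γ₀ : Fin (n + 2) → ℂ) (β γ : Fin (n + 2) → Fin k' → ℂ),
        (∀ i, IsAlgebraic ℚ (β₀ i)) → (∀ i j, IsAlgebraic ℚ (β i j)) → (∀ i, IsAlgebraic ℚ (γ₀ i)) →
        (∀ i j, IsAlgebraic ℚ (γ i j)) → (∀ i, x i = β₀ i + ∑ j, β i j * t' j) →
        (∀ i, Complex.exp (x i) = γ₀ i + ∑ j, γ i j * t' j) → n + 2 ≤ k' :=
      fun k' t' β₀ γ₀ β γ hβ₀ hβ hγ₀ hγ hxr her =>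
        hquad k' t' β₀ γ₀ β γ (fun _ _ _ => 0) (fun _ _ _ => 0) hβ₀ hβ (fun _ _ _ => isAlgebraic_zero)
          hγ₀ hγ (fun _ _ _ => isAlgebraic_zero) (fun i => by simp [hxr i]) (fun i => by simp [her i])
    have htight := hB (n + 2) x hxli
    have hone : ∀ m, IsAlgebraic ℚ (MvPolynomial.coeff m (1 : MvPolynomial (Fin (k + 2)) ℂ)) := by
      intro m
      rw [← (MvPolynomial.map (algebraMap Qbar ℂ)).map_one]
      exact algCoeff_map 1 m
    have hle : n + 2 ≤ k + 2 :=
      hU (n + 2) (k + 2) x s 1 (fun i => MvPolynomial.map (algebraMap Qbar ℂ) (N' i))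
        (fun i => MvPolynomial.map (algebraMap Qbar ℂ) (E' i)) hxli haff hquad htight hone
        (fun i m => algCoeff_map (N' i) m) (fun i m => algCoeff_map (E' i) m) (by simp)
        (fun i => by rw [map_one, mul_one, eval_map_Qbar]; exact hxN' i)
        (fun i => by rw [map_one, mul_one, eval_map_Qbar]; exact hxE' i)
    omega

/-- **B ∧ U⊥ ⟹ L.** -/
theorem linearSchanuel_of_defectOne_rationalImage (hB : DefectOneSchanuel) (hU : RationalImageSchanuel) :
    LinearSchanuel := by
  intro n k z t β₀ γ₀ β γ hz hβ₀ hβ hγ₀ hγ hzr her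
  refine collapse_core hB hU (d := 2) (by norm_num) z t hz
    (fun i => quad ⟨β₀ i, hβ₀ i⟩ (fun j => ⟨β i j, hβ i j⟩) (fun _ _ => 0))
    (fun i => quad ⟨γ₀ i, hγ₀ i⟩ (fun j => ⟨γ i j, hγ i j⟩) (fun _ _ => 0))
    (fun i => totalDegree_quad_le _ _ _) (fun i => ?_) (fun i => ?_)
  · rw [aeval_quad]; simpa using hzr i
  · rw [aeval_quad]; simpa using her i

/-- **B ∧ U⊥ ⟹ Q.** -/
theorem quadraticSchanuel_of_defectOne_rationalImage (hB : DefectOneSchanuel)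
    (hU : RationalImageSchanuel) : QuadraticSchanuel := by
  intro n k z t β₀ γ₀ β γ δ ε hz _ hβ₀ hβ hδ hγ₀ hγ hε hzr her
  refine collapse_core hB hU (d := 2) (by norm_num) z t hz
    (fun i => quad ⟨β₀ i, hβ₀ i⟩ (fun j => ⟨β i j, hβ i j⟩) (fun j j' => ⟨δ i j j', hδ i j j'⟩))
    (fun i => quad ⟨γ₀ i, hγ₀ i⟩ (fun j => ⟨γ i j, hγ i j⟩) (fun j j' => ⟨ε i j j', hε i j j'⟩))
    (fun i => totalDegree_quad_le _ _ _) (fun i => ?_) (fun i => ?_)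
  · rw [aeval_quad]; exact hzr i
  · rw [aeval_quad]; exact her i

/-! ## 7. The support item `LadderCollapseGlue` (route rev 21/22, stmt-Schanuel-26483) -/

/-- **B → U⊥ → L ∧ Q**: closes the route's support item `LadderCollapseGlue` (mechanism M2 of the critic's
VERDICT 2026-08-30T15:10:24Z; lens-1 g12 prover/LadderCollapseGlue.addendum.lean.txt). -/
theorem ladderCollapseGlue_holds : Summit.Schanuel.Schanuel.Theses.RootDecomp1.LadderCollapseGlue := fun hB hU =>
  ⟨linearSchanuel_of_defectOne_rationalImage hB hU, quadraticSchanuel_of_defectOne_rationalImage hB hU⟩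

end Summit.Schanuel.Schanuel.Theorems.RootDecomp1LadderCollapse
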